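/-
Copyright (c) 2026. All rights reserved.
Released under Apache 2.0 license as described in the file LICENSE.
Authors: hodgecm-mathlib cell (D-0151), fan A, seat A-p10.
-/
import Literature.NumberTheory.Automorphic.UnitaryDualPairDoubledLineBigCell
import Mathlib.Topology.Algebra.InfiniteSum.Group
import HarnessLib

/-!
# The Cayley index of a rank-one unitary group: `U(T_W)(F) ∖ {1} ≃ F`, `γ ↦ β(γ) = q ∕ (2(1 − p))`

Topic `NumberTheory/Automorphic`; namespace `Literature.NumberTheory.Automorphic.UnitaryGroup` (continues
`UnitaryDualPairDoubledLineBigCell` §2, SAME SPELLING: `γ ∈ U(T_W)(F) = rational F E c 1 (T_W ⊗ 1)`, `γ₀₀ = p + q δ` in quadratic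
coordinates `Ψ`, `p = re Ψ γ₀₀`, `q = im Ψ γ₀₀`, Cayley parameter `β(γ) = q ∕ (2(1 − p))`).  KERNEL ONLY: theorems; no definition, no
named fact, no instance, no `sorry`.

THE PRINT. [GelbartPiatetskishapiroRallis1987, Part A §2 pp. 7–9] (the main orbit of `P \ Sp` for the doubled rank-one pair is
parametrised by the split torus ∖ identity, i.e. by one affine coordinate) and [Weil1965, n° 46 p. 66] (the big cell of `P_W(k) \ U(W□)(k)`
is an affine line over `k`): the norm-one group `E¹ = {γ ∈ E : γ γ̄ = 1} = U(T_W)(F)` of a quadratic extension `E = F(δ)`, `δ² = d`,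
minus the identity, is in BIJECTION with `F` under the Cayley map `γ = p + qδ ↦ β = q ∕ (2(1 − p))`, with inverse
`β ↦ γ_β = ((1 + 4dβ²) + (−4β) δ) ∕ (4dβ² − 1)` (`4dβ² ≠ 1` because `d` is not a square in `F`).  This is the INDEX SET of the unfolded
Siegel Eisenstein series of the E-2 child line: `P_W(F) \ U(W□)(F) ≅ U(T_W)(F)` (SW3), the point `γ = 1` is the small cell and
`γ ≠ 1 ↔ β ∈ F` the big cell, so `E(Ψ) = f_Ψ(1) + Σ'_{β ∈ F} (cell term at γ_β)`.

* §1 `four_mul_mul_sq_sub_one_ne_zero` — `4dβ² − 1 ≠ 0`; `re_eq_of_ne_one` — `p = (1 + 4dβ²) ∕ (4dβ² − 1)` for `γ ≠ 1`;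
  **`cayley_injective`**; **`exists_ne_one_cayley_eq`** (`γ_β`); **`bijective_cayley`** — `{γ ∕∕ γ ≠ 1} → F` is a bijection;
* §2 TRANSPORT (any topological additive group `M`): `summable_comp_cayley_iff`, `tsum_comp_cayley`, and the «drop `γ = 1`» pair
  `summable_iff_summable_subtype_ne_one`, `tsum_eq_apply_one_add_tsum_subtype_ne_one`; combined: **`summable_iff_of_eq_comp_cayley`**,
  **`tsum_eq_apply_one_add_tsum_of_eq_comp_cayley`** — `Σ'_γ f γ = f 1 + Σ'_{β ∈ F} G β` whenever `f γ = G (β γ)` off the identity;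
* §3 the same at the tree's rational coordinates `quadraticRatCoords` (spelling of ★ `…BigCell`'s headline): `bijective_cayley_rat`.

USE (cell `hodgecm-mathlib`, FLOOR-0 P4, ENGINE E-2 child `Cruxes/H413/Lines/F0_E2SiegelWeilWeilRange.lean`, `stub_SW2_siegelWeil` (iii), road (W),
rows SUM-iii (A-p10) and EIS-UNFOLD (C2) (B-p02)): the common index `Option F ≃ U(T_W)(F)` of both.  HC_CM is proved only modulo the printed
citations until rung 0 closes.

## References
* [GelbartPiatetskishapiroRallis1987] S. Gelbart, I. Piatetski-Shapiro, S. Rallis, *Explicit constructions of automorphic L-functions*,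
  LNM 1254 (1987), Part A §2 pp. 7–9.
* [Weil1965] A. Weil, Acta Math. 113 (1965) 1–87, n° 46 p. 66.
* [Mok2014] C. P. Mok, Mem. AMS 235 (2015), §1 Notation p. 5 (`U_{E/F}(1) = E¹`).
-/

set_option autoImplicit false

noncomputable section

open Literature.NumberTheory.GelbartRogawski1991 Literature.NumberTheory.GelbartRogawski1991.UnitaryDualPair

namespace Literature.NumberTheory.Automorphic

namespace UnitaryGroup

/-! ## §1 The Cayley index in quadratic coordinates -/

section CayleyIndex

variable {F E : Type} [Field F] [CharZero F] [Field E] [Algebra F E] (c : E ≃ₐ[F] E) {δ : E} (hcδ : c δ = -δ) (hδ : δ ≠ 0)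
  {d : F} {Ψ : (F × F) ≃+ E} (h : IsQuadraticCoordinates (algebraMap F E) Ψ δ d)
  {TW : Matrix (Fin 1) (Fin 1) F} (hWd : IsUnit TW.det)

/-- `2 ≠ 0` in `E` (from `F`). [folklore] -/
private theorem two_ne_zero_ext (K L : Type) [Field K] [CharZero K] [Field L] [Algebra K L] : (2 : L) ≠ 0 := by
  rw [← map_ofNat (algebraMap K L) 2]
  exact (map_ne_zero (algebraMap K L)).2 two_ne_zero

include h hcδ in
/-- **`4dβ² ≠ 1`**: `d = δ²` with `c δ = −δ ≠ 0` is not a square in `F` (else `x = 2β·δ` would satisfy `x² = 1`, `c x = −x`, forcing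
`1 = −1`). [cite: GelbartPiatetskishapiroRallis1987, Part A §2 pp. 7–9] -/
theorem four_mul_mul_sq_sub_one_ne_zero (β : F) : 4 * d * β ^ 2 - 1 ≠ 0 := by
  intro H
  set x : E := algebraMap F E (2 * β) * δ with hx
  have hx2 : x * x = 1 := by
    have h1 : x * x = algebraMap F E ((2 * β) * (2 * β) * d) := by
      rw [map_mul, map_mul, ← h.mul_self, hx]; ring
    rw [h1, show (2 * β) * (2 * β) * d = 1 by linear_combination H, map_one]
  have hcx : c x = -x := by
    rw [hx, map_mul, AlgEquiv.commutes, hcδ, mul_neg]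
  rcases mul_self_eq_one_iff.1 hx2 with h1 | h1
  · rw [h1, map_one] at hcx
    exact two_ne_zero_ext F E (by linear_combination hcx)
  · rw [h1, map_neg, map_one] at hcx
    exact two_ne_zero_ext F E (by linear_combination -hcx)

include h hcδ hδ hWd in
/-- **`p = (1 + 4dβ²) ∕ (4dβ² − 1)`** for `γ ≠ 1` with Cayley parameter `β` (eliminate `q` between ★ `2β(1 − p) = q` and
★ `2dqβ + p + 1 = 0`). [cite: GelbartPiatetskishapiroRallis1987, Part A §2 pp. 7–9] -/
theorem re_eq_of_ne_one (γ : rational F E c 1 (TW.map (algebraMap F E))) (hγ : γ ≠ 1) :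
    QuadraticCoordinates.re Ψ (((γ : GL (Fin 1) E) : Matrix (Fin 1) (Fin 1) E) 0 0) =
      (1 + 4 * d * (QuadraticCoordinates.im Ψ (((γ : GL (Fin 1) E) : Matrix (Fin 1) (Fin 1) E) 0 0) /
          (2 * (1 - QuadraticCoordinates.re Ψ (((γ : GL (Fin 1) E) : Matrix (Fin 1) (Fin 1) E) 0 0)))) ^ 2) /
        (4 * d * (QuadraticCoordinates.im Ψ (((γ : GL (Fin 1) E) : Matrix (Fin 1) (Fin 1) E) 0 0) /
          (2 * (1 - QuadraticCoordinates.re Ψ (((γ : GL (Fin 1) E) : Matrix (Fin 1) (Fin 1) E) 0 0)))) ^ 2 - 1) := by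
  have h1 := two_mul_cayley_mul_one_sub_re c hcδ hδ h hWd γ hγ
  have h2 := two_mul_mul_im_mul_cayley_add c hcδ hδ h hWd γ hγ
  have hD := four_mul_mul_sq_sub_one_ne_zero c hcδ h
    (QuadraticCoordinates.im Ψ (((γ : GL (Fin 1) E) : Matrix (Fin 1) (Fin 1) E) 0 0) /
      (2 * (1 - QuadraticCoordinates.re Ψ (((γ : GL (Fin 1) E) : Matrix (Fin 1) (Fin 1) E) 0 0))))
  rw [eq_div_iff hD]
  linear_combination (-(2 * d * (QuadraticCoordinates.im Ψ (((γ : GL (Fin 1) E) : Matrix (Fin 1) (Fin 1) E) 0 0) /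
      (2 * (1 - QuadraticCoordinates.re Ψ (((γ : GL (Fin 1) E) : Matrix (Fin 1) (Fin 1) E) 0 0)))))) * h1 - h2

include h hcδ hδ hWd in
/-- **THE CAYLEY MAP IS INJECTIVE off the identity**: `β(γ) = β(γ')`, `γ, γ' ≠ 1` `⇒ γ = γ'` (`p` and then `q = 2β(1 − p)` are
determined by `β`). [cite: GelbartPiatetskishapiroRallis1987, Part A §2 pp. 7–9] -/
theorem cayley_injective (γ γ' : rational F E c 1 (TW.map (algebraMap F E))) (hγ : γ ≠ 1) (hγ' : γ' ≠ 1)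
    (hβ : QuadraticCoordinates.im Ψ (((γ : GL (Fin 1) E) : Matrix (Fin 1) (Fin 1) E) 0 0) /
        (2 * (1 - QuadraticCoordinates.re Ψ (((γ : GL (Fin 1) E) : Matrix (Fin 1) (Fin 1) E) 0 0))) =
      QuadraticCoordinates.im Ψ (((γ' : GL (Fin 1) E) : Matrix (Fin 1) (Fin 1) E) 0 0) /
        (2 * (1 - QuadraticCoordinates.re Ψ (((γ' : GL (Fin 1) E) : Matrix (Fin 1) (Fin 1) E) 0 0)))) :
    γ = γ' := by
  have hp := re_eq_of_ne_one c hcδ hδ h hWd γ hγ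
  have hp' := re_eq_of_ne_one c hcδ hδ h hWd γ' hγ'
  rw [hβ] at hp
  have hpp : QuadraticCoordinates.re Ψ (((γ : GL (Fin 1) E) : Matrix (Fin 1) (Fin 1) E) 0 0) =
      QuadraticCoordinates.re Ψ (((γ' : GL (Fin 1) E) : Matrix (Fin 1) (Fin 1) E) 0 0) := hp.trans hp'.symm
  have hq := (two_mul_cayley_mul_one_sub_re c hcδ hδ h hWd γ hγ).symm
  have hq' := (two_mul_cayley_mul_one_sub_re c hcδ hδ h hWd γ' hγ').symm
  rw [hβ, hpp] at hq
  have hqq : QuadraticCoordinates.im Ψ (((γ : GL (Fin 1) E) : Matrix (Fin 1) (Fin 1) E) 0 0) =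
      QuadraticCoordinates.im Ψ (((γ' : GL (Fin 1) E) : Matrix (Fin 1) (Fin 1) E) 0 0) := hq.trans hq'.symm
  have h00 : ((γ : GL (Fin 1) E) : Matrix (Fin 1) (Fin 1) E) 0 0 = ((γ' : GL (Fin 1) E) : Matrix (Fin 1) (Fin 1) E) 0 0 := by
    rw [← h.re_add_im (((γ : GL (Fin 1) E) : Matrix (Fin 1) (Fin 1) E) 0 0),
      ← h.re_add_im (((γ' : GL (Fin 1) E) : Matrix (Fin 1) (Fin 1) E) 0 0), hpp, hqq]
  refine Subtype.ext (Units.ext (Matrix.ext fun i j => ?_))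
  rw [Fin.fin_one_eq_zero i, Fin.fin_one_eq_zero j]
  exact h00

include h hcδ in
/-- **THE CAYLEY MAP IS SURJECTIVE onto `F`**: for every `β ∈ F` the norm-one element
`γ_β = p + q δ`, `p = (1 + 4dβ²)/(4dβ² − 1)`, `q = −4β/(4dβ² − 1)` (`p² − dq² = 1`) lies in `U(T_W)(F)`, is `≠ 1` (`p = 1` would give
`2 = 0`), and has Cayley parameter `q ∕ (2(1 − p)) = β`. [cite: GelbartPiatetskishapiroRallis1987, Part A §2 pp. 7–9] -/
theorem exists_ne_one_cayley_eq (TW : Matrix (Fin 1) (Fin 1) F) (β : F) :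
    ∃ γ : rational F E c 1 (TW.map (algebraMap F E)), γ ≠ 1 ∧
      QuadraticCoordinates.im Ψ (((γ : GL (Fin 1) E) : Matrix (Fin 1) (Fin 1) E) 0 0) /
          (2 * (1 - QuadraticCoordinates.re Ψ (((γ : GL (Fin 1) E) : Matrix (Fin 1) (Fin 1) E) 0 0))) = β := by
  have hD := four_mul_mul_sq_sub_one_ne_zero c hcδ h β
  set p : F := (1 + 4 * d * β ^ 2) / (4 * d * β ^ 2 - 1) with hp
  set q : F := -(4 * β) / (4 * d * β ^ 2 - 1) with hq
  have hpq : p * p - d * (q * q) = 1 := by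
    rw [hp, hq]
    field_simp
    ring
  set x : E := algebraMap F E p + algebraMap F E q * δ with hx
  have hcx : c x = algebraMap F E p - algebraMap F E q * δ := by
    rw [hx, map_add, map_mul, AlgEquiv.commutes, AlgEquiv.commutes, hcδ]
    ring
  have hnorm : c x * x = 1 := by
    have h1 : (algebraMap F E p - algebraMap F E q * δ) * (algebraMap F E p + algebraMap F E q * δ) =
        algebraMap F E (p * p - d * (q * q)) := by
      rw [map_sub, map_mul, map_mul, map_mul, ← h.mul_self]
      ring
    rw [hcx, hx, h1, hpq, map_one]
  have hx0 : x ≠ 0 := by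
    intro h0
    rw [h0, mul_zero] at hnorm
    exact zero_ne_one hnorm
  set g : GL (Fin 1) E := Matrix.GeneralLinearGroup.mkOfDetNeZero !![x] (by rw [Matrix.det_fin_one_of]; exact hx0) with hg
  have hg00 : (g : Matrix (Fin 1) (Fin 1) E) = !![x] := by
    rw [hg, Matrix.GeneralLinearGroup.val_mkOfDetNeZero]
  have hmem : g ∈ rational F E c 1 (TW.map (algebraMap F E)) := by
    rw [rational, mem_unitaryGroupOfForm_iff, hg00]
    ext i j
    rw [Fin.fin_one_eq_zero i, Fin.fin_one_eq_zero j]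
    simp only [Matrix.mul_apply, Fin.sum_univ_one, Matrix.transpose_apply, Matrix.map_apply, Matrix.of_apply,
      Matrix.cons_val', Matrix.cons_val_fin_one, Matrix.empty_val', RingHom.coe_coe]
    linear_combination (algebraMap F E (TW 0 0)) * hnorm
  refine ⟨⟨g, hmem⟩, ?_, ?_⟩
  · intro h1
    have h00 : x = 1 := by
      have h1' := congrArg (fun γ : rational F E c 1 (TW.map (algebraMap F E)) => ((γ : GL (Fin 1) E) : Matrix (Fin 1) (Fin 1) E) 0 0) h1
      simpa [hg00] using h1'
    have hre : QuadraticCoordinates.re Ψ x = p := by rw [hx]; exact h.re_eq p q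
    rw [h00, h.re_one, hp, eq_div_iff hD] at hre
    exact (two_ne_zero (α := F)) (by linear_combination -hre)
  · have hre : QuadraticCoordinates.re Ψ (((g : GL (Fin 1) E) : Matrix (Fin 1) (Fin 1) E) 0 0) = p := by
      rw [hg00]; simp only [Matrix.of_apply, Matrix.cons_val', Matrix.cons_val_fin_one, Matrix.empty_val']
      rw [hx]; exact h.re_eq p q
    have him : QuadraticCoordinates.im Ψ (((g : GL (Fin 1) E) : Matrix (Fin 1) (Fin 1) E) 0 0) = q := by
      rw [hg00]; simp only [Matrix.of_apply, Matrix.cons_val', Matrix.cons_val_fin_one, Matrix.empty_val']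
      rw [hx]; exact h.im_eq p q
    show QuadraticCoordinates.im Ψ (((g : GL (Fin 1) E) : Matrix (Fin 1) (Fin 1) E) 0 0) /
        (2 * (1 - QuadraticCoordinates.re Ψ (((g : GL (Fin 1) E) : Matrix (Fin 1) (Fin 1) E) 0 0))) = β
    rw [hre, him]
    have h2p : 2 * (1 - p) = -4 / (4 * d * β ^ 2 - 1) := by
      rw [hp]
      field_simp
      ring
    rw [h2p, hq]
    have hD' : 4 * β ^ 2 * d - 1 ≠ 0 := by convert hD using 1; ring
    field_simp

include h hcδ hδ hWd in
/-- **THE CAYLEY INDEX**: `γ ↦ β(γ) = q ∕ (2(1 − p))` is a BIJECTION `U(T_W)(F) ∖ {1} → F`. [cite: GelbartPiatetskishapiroRallis1987, Part A §2 pp. 7–9]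
[cite: Weil1965, n° 46 p. 66] -/
theorem bijective_cayley :
    Function.Bijective (fun γ : {γ : rational F E c 1 (TW.map (algebraMap F E)) // γ ≠ 1} =>
      QuadraticCoordinates.im Ψ (((γ.1 : GL (Fin 1) E) : Matrix (Fin 1) (Fin 1) E) 0 0) /
        (2 * (1 - QuadraticCoordinates.re Ψ (((γ.1 : GL (Fin 1) E) : Matrix (Fin 1) (Fin 1) E) 0 0)))) := by
  refine ⟨fun a b hab => Subtype.ext (cayley_injective c hcδ hδ h hWd a.1 b.1 a.2 b.2 hab), fun β => ?_⟩
  obtain ⟨γ, hγ, hβ⟩ := exists_ne_one_cayley_eq c hcδ h TW β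
  exact ⟨⟨γ, hγ⟩, hβ⟩

/-! ## §2 Transport of sums along the Cayley index -/

include h hcδ hδ hWd in
/-- **summability transport**: `Σ_{γ ≠ 1} G(β(γ))` converges iff `Σ_{β ∈ F} G(β)` does. [cite: Weil1965, n° 46 p. 66] -/
theorem summable_comp_cayley_iff {M : Type*} [AddCommMonoid M] [TopologicalSpace M] (G : F → M) :
    Summable (fun γ : {γ : rational F E c 1 (TW.map (algebraMap F E)) // γ ≠ 1} =>
        G (QuadraticCoordinates.im Ψ (((γ.1 : GL (Fin 1) E) : Matrix (Fin 1) (Fin 1) E) 0 0) /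
          (2 * (1 - QuadraticCoordinates.re Ψ (((γ.1 : GL (Fin 1) E) : Matrix (Fin 1) (Fin 1) E) 0 0))))) ↔
      Summable G :=
  (Equiv.ofBijective _ (bijective_cayley c hcδ hδ h hWd)).summable_iff (f := G)

include h hcδ hδ hWd in
/-- **`tsum` transport**: `Σ'_{γ ≠ 1} G(β(γ)) = Σ'_{β ∈ F} G(β)`. [cite: Weil1965, n° 46 p. 66] -/
theorem tsum_comp_cayley {M : Type*} [AddCommMonoid M] [TopologicalSpace M] (G : F → M) :
    ∑' γ : {γ : rational F E c 1 (TW.map (algebraMap F E)) // γ ≠ 1},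
        G (QuadraticCoordinates.im Ψ (((γ.1 : GL (Fin 1) E) : Matrix (Fin 1) (Fin 1) E) 0 0) /
          (2 * (1 - QuadraticCoordinates.re Ψ (((γ.1 : GL (Fin 1) E) : Matrix (Fin 1) (Fin 1) E) 0 0)))) =
      ∑' β, G β :=
  Equiv.tsum_eq (Equiv.ofBijective _ (bijective_cayley c hcδ hδ h hWd)) G

end CayleyIndex

/-! ### Dropping the identity term (any index group) -/

section DropOne

variable {Γ : Type*} [One Γ] {M : Type*} [AddCommGroup M] [TopologicalSpace M] [IsTopologicalAddGroup M]

/-- `Σ_γ f γ` converges iff `Σ_{γ ≠ 1} f γ` does (one term dropped). [folklore] -/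
private theorem subtypeEquiv_notMem_singleton :
    ∀ x : Γ, x ∉ ({1} : Finset Γ) ↔ x ≠ 1 := fun x => by rw [Finset.mem_singleton]

/-- **`Summable f ↔ Summable (f on γ ≠ 1)`.** [cite: Weil1965, n° 39 (30) p. 57] -/
theorem summable_iff_summable_subtype_ne_one (f : Γ → M) :
    Summable f ↔ Summable (fun γ : {γ : Γ // γ ≠ 1} => f γ.1) := by
  rw [← Finset.summable_compl_iff (f := f) ({1} : Finset Γ)]
  exact (Equiv.subtypeEquivRight subtypeEquiv_notMem_singleton).summable_iff
    (f := fun γ : {γ : Γ // γ ≠ 1} => f γ.1)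

/-- **`Σ'_γ f γ = f 1 + Σ'_{γ ≠ 1} f γ`** for summable `f`. [cite: Weil1965, n° 39 (30) p. 57] -/
theorem tsum_eq_apply_one_add_tsum_subtype_ne_one [T2Space M] (f : Γ → M) (hf : Summable f) :
    ∑' γ, f γ = f 1 + ∑' γ : {γ : Γ // γ ≠ 1}, f γ.1 := by
  rw [← hf.sum_add_tsum_compl (s := ({1} : Finset Γ)), Finset.sum_singleton]
  congr 1
  have hs : ∀ x : Γ, x ∈ ((↑({1} : Finset Γ) : Set Γ)ᶜ) ↔ x ≠ 1 := fun x => by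
    rw [Set.mem_compl_iff, Finset.coe_singleton, Set.mem_singleton_iff]
  exact Equiv.tsum_eq (Equiv.subtypeEquivRight hs) (fun γ : {γ : Γ // γ ≠ 1} => f γ.1)

end DropOne

/-! ### The combined statement consumed by (C2) / SUM-iii -/

section Combined

variable {F E : Type} [Field F] [CharZero F] [Field E] [Algebra F E] (c : E ≃ₐ[F] E) {δ : E} (hcδ : c δ = -δ) (hδ : δ ≠ 0)
  {d : F} {Ψ : (F × F) ≃+ E} (h : IsQuadraticCoordinates (algebraMap F E) Ψ δ d)
  {TW : Matrix (Fin 1) (Fin 1) F} (hWd : IsUnit TW.det)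
  {M : Type*} [AddCommGroup M] [TopologicalSpace M] [IsTopologicalAddGroup M]

include h hcδ hδ hWd in
/-- **`Summable f ↔ Summable G`** when `f γ = G(β(γ))` for all `γ ≠ 1` (the identity term is irrelevant).
[cite: Weil1965, n° 39 (30) p. 57] [cite: Weil1965, n° 46 p. 66] -/
theorem summable_iff_of_eq_comp_cayley (f : rational F E c 1 (TW.map (algebraMap F E)) → M) (G : F → M)
    (hfG : ∀ γ : rational F E c 1 (TW.map (algebraMap F E)), γ ≠ 1 →
      f γ = G (QuadraticCoordinates.im Ψ (((γ : GL (Fin 1) E) : Matrix (Fin 1) (Fin 1) E) 0 0) /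
        (2 * (1 - QuadraticCoordinates.re Ψ (((γ : GL (Fin 1) E) : Matrix (Fin 1) (Fin 1) E) 0 0))))) :
    Summable f ↔ Summable G := by
  classical
  rw [summable_iff_summable_subtype_ne_one f, ← summable_comp_cayley_iff c hcδ hδ h hWd G]
  exact summable_congr fun γ => hfG γ.1 γ.2

include h hcδ hδ hWd in
/-- **`Σ'_γ f γ = f 1 + Σ'_{β ∈ F} G β`** when `f γ = G(β(γ))` for all `γ ≠ 1` and `f` is summable — the shape
`E(Ψ) = f_Ψ(1) + Σ'_{β ∈ F} F*(β)` of the unfolded Eisenstein series. [cite: Weil1965, n° 39 (30) p. 57] [cite: Weil1965, n° 46 p. 66] -/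
theorem tsum_eq_apply_one_add_tsum_of_eq_comp_cayley [T2Space M] (f : rational F E c 1 (TW.map (algebraMap F E)) → M) (G : F → M)
    (hfG : ∀ γ : rational F E c 1 (TW.map (algebraMap F E)), γ ≠ 1 →
      f γ = G (QuadraticCoordinates.im Ψ (((γ : GL (Fin 1) E) : Matrix (Fin 1) (Fin 1) E) 0 0) /
        (2 * (1 - QuadraticCoordinates.re Ψ (((γ : GL (Fin 1) E) : Matrix (Fin 1) (Fin 1) E) 0 0)))))
    (hf : Summable f) :
    ∑' γ, f γ = f 1 + ∑' β, G β := by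
  classical
  rw [tsum_eq_apply_one_add_tsum_subtype_ne_one f hf, ← tsum_comp_cayley c hcδ hδ h hWd G]
  congr 1
  exact tsum_congr fun γ => hfG γ.1 γ.2

end Combined

/-! ## §3 At the tree's rational coordinates `quadraticRatCoords` (the spelling of ★ `…BigCell`'s headline) -/

section Rat

variable (F E : Type) [Field F] [NumberField F] [Field E] [NumberField E] [Algebra F E] [Algebra.IsQuadraticExtension F E]
  (c : E ≃ₐ[F] E) {δ : E} (hcδ : c δ = -δ) (hδ : δ ≠ 0) {d : F} (hd : δ * δ = algebraMap F E d)
  {TW : Matrix (Fin 1) (Fin 1) F} (hWd : IsUnit TW.det)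

include hd hWd in
/-- **THE CAYLEY INDEX at `quadraticRatCoords`**: `{γ ∈ U(T_W)(F) ∕∕ γ ≠ 1} → F`, `γ ↦ q ∕ (2(1 − p))`, is a bijection.
[cite: GelbartPiatetskishapiroRallis1987, Part A §2 pp. 7–9] [cite: Weil1965, n° 46 p. 66] -/
theorem bijective_cayley_rat :
    Function.Bijective (fun γ : {γ : rational F E c 1 (TW.map (algebraMap F E)) // γ ≠ 1} =>
      QuadraticCoordinates.im (quadraticRatCoords E (not_mem_range_algebraMap_of_apply_eq_neg E c hcδ hδ)).toAddEquiv
          (((γ.1 : GL (Fin 1) E) : Matrix (Fin 1) (Fin 1) E) 0 0) /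
        (2 * (1 - QuadraticCoordinates.re (quadraticRatCoords E (not_mem_range_algebraMap_of_apply_eq_neg E c hcδ hδ)).toAddEquiv
          (((γ.1 : GL (Fin 1) E) : Matrix (Fin 1) (Fin 1) E) 0 0)))) :=
  bijective_cayley c hcδ hδ (isQuadraticCoordinates_rat E c hcδ hδ hd) hWd

end Rat

end UnitaryGroup

end Literature.NumberTheory.Automorphic

end
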